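import Summits.HodgeConjecture.HodgeConjecture.Theorems.Ring2AtlasCMSixfolds
import Literature.AlgebraicGeometry.ComplexMultiplication.PrimitiveCMTypeSimple
import Literature.NumberTheory.ComplexMultiplication.CMTypeDictionary
import Literature.AlgebraicGeometry.Motives.ZarhinHodgeGroupAutC
import Mathlib.NumberTheory.Cyclotomic.PrimitiveRoots
import Mathlib.NumberTheory.Cyclotomic.Gal
import Mathlib.NumberTheory.NumberField.CMField
import Mathlib.NumberTheory.NumberField.Cyclotomic.Basic
import Mathlib.NumberTheory.NumberField.InfinitePlace.Embeddings
import Mathlib.RingTheory.RootsOfUnity.Complex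
import Mathlib.Algebra.Algebra.Hom.Rat
import Mathlib.FieldTheory.Galois.Basic
import Mathlib.FieldTheory.Galois.Abelian
import Mathlib.Data.ZMod.QuotientGroup
import HarnessLib

set_option linter.dupNamespace false

/-!
# Ring 2 · atlas-2 — carriers of the `E × Y₅` non-vacuity witness: the cyclic CM field of degree 10 in `ℚ(ζ₃₃)`

HONEST FRAMING: research route conditional on HC_CM; not a corollary; Q11.4-sentence-2 already refuted in dim ≥ 3.

Cell `pub-hodge-ring2`, seat `pub-hodge-ring2-atlas-2` (generation 52). First half (split for the 400-line
lint) of the non-vacuity proof for the OPEN `g = 6` cell `HodgePowersOfCMEllipticTimesUnitaryFivefold`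
(`Ring2AtlasSixfolds` §3: powers of `E × Y`, `E` a CM elliptic curve and `Y` a simple abelian FIVEFOLD, both
with multiplication by the same imaginary quadratic field `k = ℚ(√-d)`); the second half — the CM type, its
primitivity, the endomorphism `√-3` and the non-vacuity theorems — is `Ring2AtlasUnitaryFivefoldCellNonVacuity`.
The witness takes `d = 3`: `Y` is a simple CM abelian fivefold whose CM field contains `ζ₃`, i.e. a CM field
of degree `10` containing `ℚ(√-3)`. The one used here is the cyclic subfield `K` of degree `10` of `ℚ(ζ₃₃)`
fixed by `ζ ↦ ζ¹⁰` (`10² = 100 ≡ 1 mod 33`); it contains `ζ₃ = ζ₃₃¹¹` (`11 · 10 ≡ 11 mod 33`) and is NOT the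
maximal real subfield (that one is fixed by `ζ ↦ ζ³² = ζ⁻¹`). Shimura 1998 §8.4, after Example (1) [held text
`book:shimura1998-abelian-varieties-with-complex-multiplication-modular-functions`, chunk p0085, verbatim]:
«We can similarly treat the case where `F` is cyclic over `Q`.» (`Gal(K/ℚ) = (ℤ/33)^×/{1, 10}` has order
`10`, hence is cyclic.)

Contents (namespace `Cyclotomic33`; Mathlib carriers; every statement proved outright, no hypothesis; the
layout follows `Ring2AtlasCMSevenfoldsCyclotomic43` (generation 48) with the composite conductor `33` — units
are tracked by `Nat.Coprime · 33` instead of `0 < ·`):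
* `L33 := CyclotomicField 33 ℚ`: `[L33 : ℚ] = φ(33) = 20` (`finrank_L33`), Galois over `ℚ`; `ζ := zeta 33`,
  `μ := e^{2πi/33} ∈ ℂ`, `conj μ = μ³²`; complex embeddings of `ℚ(ζ₃₃)` ↔ exponents prime to `33`
  (`exists_apply_ζ_eq`, `exists_embedding_apply_ζ_eq` via `IsPrimitiveRoot.embeddingsEquivPrimitiveRoots`,
  `ringHom_ext_ζ` via the power basis); `Aut(ℂ)` is transitive on them (`exists_ringEquiv_comp_eq`, from
  `Motives.ZarhinLie.exists_ringEquiv_complex_comp_eq`).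
* `σ : ζ ↦ ζ¹⁰` (`IsCyclotomicExtension.fromZetaAut`), `σ² = 1 ≠ σ`, `orderOf σ = 2`; `H := ⟨σ⟩`, `|H| = 2`;
  elements of `H` send `ζ ↦ ζ^(10^j)`, `j < 2` (`exists_apply_ζ_of_mem_H`).
* `K10 := ℚ(ζ₃₃)^H` (`IntermediateField.fixedField H`): `[ℚ(ζ₃₃) : K] = 2`, `[K : ℚ] = 10` (`finrank_K10`),
  `Gal(ℚ(ζ₃₃)/K) = H` (`fixingSubgroup_K10`), `x ∈ K ⟺ σ x = x` (`mem_K10_iff`); every complex embedding of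
  `K` extends to `ℚ(ζ₃₃)` (`exists_extension`) and two extensions of one embedding differ by an element of
  `H`, i.e. have exponents `a`, `a·10^j` (`exists_exponent_of_comp_eq`); `K` is totally complex (complex
  conjugation `ζ ↦ ζ³²` is not in `H = {ζ ↦ ζ, ζ¹⁰}`: `core_negOne_notMem_H`, `decide`), abelian over `ℚ`
  (`IsAbelianGalois.of_algHom` along `K ⊂ ℚ(ζ₃₃)`), hence a CM FIELD (`instIsCMFieldK10`, Mathlib's
  `NumberField.IsCMField.of_isAbelianGalois`).
* `ω := ζ¹¹ ∈ K` (`zeta3K`, `isPrimitiveRoot_zeta3K`): a primitive cube root of unity INSIDE `K`, so `√-3 = 2ω + 1 ∈ K`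
  — the source of the endomorphism `ψ` with `ψ ≫ ψ = -3` in the companion module.

WHAT THIS IS NOT: number-field bookkeeping only — no atlas word, cell `def`, KIND or count is touched and
nothing here mentions abelian varieties or Hodge classes.

References: [Shimura1998] G. Shimura, *Abelian Varieties with Complex Multiplication and Modular Functions*,
Princeton (1998), §8.4 (p. 64); §5.5 (CM fields).
-/


noncomputable section

open Polynomial NumberField

namespace Summit.HodgeConjecture.HodgeConjecture.Ring2.Atlas

open Literature.AlgebraicGeometry Literature.AlgebraicGeometry.Motives
open Literature.AlgebraicGeometry.ComplexMultiplication
open Literature.NumberTheory.ComplexMultiplication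

namespace Cyclotomic33

/-- The thirty-third cyclotomic field `ℚ(ζ₃₃)` (Mathlib's `CyclotomicField 33 ℚ`); Shimura's Galois
closure `L`. [folklore] -/
abbrev L33 : Type := CyclotomicField 33 ℚ

/-- `ℚ(ζ₃₃)/ℚ` is the 33rd cyclotomic extension (re-registered on the `DivisionRing.toRatAlgebra` path,
as for `Cyclotomic43.L43`). [folklore] -/
instance instIsCyclotomicExtensionL33 : IsCyclotomicExtension {33} ℚ L33 :=
  CyclotomicField.isCyclotomicExtension 33 ℚ

/-- The 33rd cyclotomic polynomial is irreducible over `ℚ`. [folklore] -/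
theorem irreducible_cyclotomic33 : Irreducible (cyclotomic 33 ℚ) :=
  cyclotomic.irreducible_rat (by norm_num)

/-- `ℚ(ζ₃₃)/ℚ` is Galois. [folklore] -/
instance instIsGaloisL33 : IsGalois ℚ L33 := IsCyclotomicExtension.isGalois {33} ℚ L33

/-- `φ(33) = φ(3) φ(11) = 20`. [folklore] -/
theorem totient_33 : Nat.totient 33 = 20 := by
  rw [show (33 : ℕ) = 3 * 11 by norm_num, Nat.totient_mul (by norm_num : Nat.Coprime 3 11),
    Nat.totient_prime Nat.prime_three, Nat.totient_prime (by norm_num : Nat.Prime 11)]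

/-- `[ℚ(ζ₃₃) : ℚ] = φ(33) = 20`. [folklore] -/
theorem finrank_L33 : Module.finrank ℚ L33 = 20 := by
  rw [IsCyclotomicExtension.finrank (n := 33) L33 irreducible_cyclotomic33]
  exact totient_33

/-- The distinguished primitive 33rd root of unity `ζ ∈ ℚ(ζ₃₃)`. [folklore] -/
def ζ : L33 := IsCyclotomicExtension.zeta 33 ℚ L33

/-- `ζ` is a primitive 33rd root of unity. [folklore] -/
theorem isPrimitiveRoot_ζ : IsPrimitiveRoot ζ 33 := IsCyclotomicExtension.zeta_spec 33 ℚ L33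

/-- `ζ³³ = 1`. [folklore] -/
theorem ζ_pow_33 : ζ ^ 33 = 1 := isPrimitiveRoot_ζ.pow_eq_one

/-- Exponents of `ζ` only matter mod `33`. [folklore] -/
theorem ζ_pow_mod (n : ℕ) : ζ ^ n = ζ ^ (n % 33) := by
  conv_lhs => rw [← Nat.div_add_mod n 33]
  rw [pow_add, pow_mul, ζ_pow_33, one_pow, one_mul]

/-- `μ = e^{2πi/33} ∈ ℂ`. [folklore] -/
def μ : ℂ := Complex.exp (2 * Real.pi * Complex.I / (33 : ℕ))

/-- `μ` is a primitive 33rd root of unity in `ℂ`. [folklore] -/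
theorem isPrimitiveRoot_μ : IsPrimitiveRoot μ 33 := Complex.isPrimitiveRoot_exp 33 (by norm_num)

/-- `μ³³ = 1`. [folklore] -/
theorem μ_pow_33 : μ ^ 33 = 1 := isPrimitiveRoot_μ.pow_eq_one

/-- Exponents of `μ` only matter mod `33`. [folklore] -/
theorem μ_pow_mod (n : ℕ) : μ ^ n = μ ^ (n % 33) := by
  conv_lhs => rw [← Nat.div_add_mod n 33]
  rw [pow_add, pow_mul, μ_pow_33, one_pow, one_mul]

/-- `μ^i = μ^j` with `i, j < 33` forces `i = j`. [folklore] -/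
theorem μ_pow_inj {i j : ℕ} (hi : i < 33) (hj : j < 33) (h : μ ^ i = μ ^ j) : i = j :=
  isPrimitiveRoot_μ.pow_inj hi hj h

/-- Complex conjugation inverts `μ`: `conj μ = μ³²`. [folklore] -/
theorem conj_μ : starRingEnd ℂ μ = μ ^ 32 := by
  have h1 : ‖μ‖ = 1 := Complex.norm_eq_one_of_pow_eq_one μ_pow_33 (by norm_num)
  rw [← Complex.inv_eq_conj h1]
  have h2 : μ ^ 32 * μ = 1 := by rw [← pow_succ, μ_pow_33]
  exact inv_eq_of_mul_eq_one_left h2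

/-- Every complex embedding of `ℚ(ζ₃₃)` sends `ζ` to `μ^a` for a unique `a < 33` prime to `33`. [folklore] -/
theorem exists_apply_ζ_eq (s : L33 →+* ℂ) : ∃ a : ℕ, a < 33 ∧ a.Coprime 33 ∧ s ζ = μ ^ a := by
  have hprim : IsPrimitiveRoot (s ζ) 33 := isPrimitiveRoot_ζ.map_of_injective s.injective
  obtain ⟨i, hi, hiζ⟩ := isPrimitiveRoot_μ.eq_pow_of_pow_eq_one hprim.pow_eq_one
  refine ⟨i, hi, ?_, hiζ.symm⟩
  rw [← hiζ] at hprim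
  exact (isPrimitiveRoot_μ.pow_iff_coprime (by norm_num) i).1 hprim

/-- For every `c` prime to `33` there is a complex embedding `ζ ↦ μ^c`. [folklore] -/
theorem exists_embedding_apply_ζ_eq {c : ℕ} (hc : c.Coprime 33) : ∃ s : L33 →+* ℂ, s ζ = μ ^ c := by
  have hmem : μ ^ c ∈ primitiveRoots 33 ℂ :=
    (mem_primitiveRoots (by norm_num)).2 (isPrimitiveRoot_μ.pow_of_coprime c hc)
  refine ⟨((isPrimitiveRoot_ζ.embeddingsEquivPrimitiveRoots ℂ irreducible_cyclotomic33).symm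
    ⟨μ ^ c, hmem⟩).toRingHom, ?_⟩
  have h := isPrimitiveRoot_ζ.embeddingsEquivPrimitiveRoots_apply_coe ℂ irreducible_cyclotomic33
    ((isPrimitiveRoot_ζ.embeddingsEquivPrimitiveRoots ℂ irreducible_cyclotomic33).symm ⟨μ ^ c, hmem⟩)
  rw [Equiv.apply_symm_apply] at h
  exact h.symm

/-- A complex embedding of `ℚ(ζ₃₃)` is determined by the image of `ζ`. [folklore] -/
theorem ringHom_ext_ζ {s t : L33 →+* ℂ} (h : s ζ = t ζ) : s = t := by
  have key : s.toRatAlgHom = t.toRatAlgHom :=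
    (isPrimitiveRoot_ζ.powerBasis ℚ).algHom_ext (by
      simpa [IsPrimitiveRoot.powerBasis_gen, RingHom.toRatAlgHom_apply] using h)
  calc s = (s.toRatAlgHom : L33 →+* ℂ) := (RingHom.toRatAlgHom_toRingHom s).symm
    _ = (t.toRatAlgHom : L33 →+* ℂ) := by rw [key]
    _ = t := RingHom.toRatAlgHom_toRingHom t

/-- A `ℚ`-automorphism of `ℚ(ζ₃₃)` is determined by the image of `ζ`. [folklore] -/
theorem algEquiv_ext_ζ {f g : L33 ≃ₐ[ℚ] L33} (h : f ζ = g ζ) : f = g := by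
  apply AlgEquiv.coe_toAlgHom_injective
  exact (isPrimitiveRoot_ζ.powerBasis ℚ).algHom_ext (by
    simpa [IsPrimitiveRoot.powerBasis_gen] using h)

/-- `Aut(ℂ)` is transitive on the complex embeddings of `ℚ(ζ₃₃)`. [folklore] -/
theorem exists_ringEquiv_comp_eq (s s' : L33 →+* ℂ) : ∃ τ : ℂ ≃+* ℂ, ∀ x, τ (s x) = s' x := by
  haveI : Countable L33 := Countable.of_equiv _ (Module.finBasis ℚ L33).equivFun.toEquiv.symm
  exact Motives.ZarhinLie.exists_ringEquiv_complex_comp_eq s s'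

/-! ### The involution `σ : ζ ↦ ζ¹⁰` and the subgroup `H = ⟨σ⟩` of order `2` -/

/-- `ζ¹⁰` is again a primitive 33rd root of unity. [folklore] -/
theorem isPrimitiveRoot_ζ10 : IsPrimitiveRoot (ζ ^ 10) 33 :=
  isPrimitiveRoot_ζ.pow_of_coprime 10 (by decide)

/-- The automorphism `σ` of `ℚ(ζ₃₃)` with `σ ζ = ζ¹⁰` (`10` has order `2` in `(ℤ/33)^×`). [folklore] -/
def σ : L33 ≃ₐ[ℚ] L33 := IsCyclotomicExtension.fromZetaAut isPrimitiveRoot_ζ10 irreducible_cyclotomic33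

/-- `σ ζ = ζ¹⁰`. [folklore] -/
theorem σ_ζ : σ ζ = ζ ^ 10 := IsCyclotomicExtension.fromZetaAut_spec isPrimitiveRoot_ζ10 irreducible_cyclotomic33

/-- `σⁿ ζ = ζ^(10ⁿ)`. [folklore] -/
theorem σ_pow_ζ (n : ℕ) : (σ ^ n) ζ = ζ ^ (10 ^ n) := by
  induction n with
  | zero => simp
  | succ n ih => rw [pow_succ, AlgEquiv.mul_apply, σ_ζ, map_pow, ih, ← pow_mul, ← pow_succ]

/-- `σ² = 1` (`10² = 100 ≡ 1 mod 33`). [folklore] -/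
theorem σ_pow_two : σ ^ 2 = 1 := by
  apply algEquiv_ext_ζ
  rw [σ_pow_ζ, AlgEquiv.one_apply, ζ_pow_mod]
  norm_num

/-- `σ ≠ 1`. [folklore] -/
theorem σ_ne_one : σ ≠ 1 := by
  intro h
  have h10 : ζ ^ 10 = ζ ^ 1 := by rw [pow_one, ← σ_ζ, h, AlgEquiv.one_apply]
  have := isPrimitiveRoot_ζ.pow_inj (by norm_num) (by norm_num) h10
  omega

/-- `σ` has order `2`. [folklore] -/
theorem orderOf_σ : orderOf σ = 2 :=
  haveI : Fact (Nat.Prime 2) := ⟨Nat.prime_two⟩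
  orderOf_eq_prime σ_pow_two σ_ne_one

/-- `H = ⟨σ⟩ ≤ Gal(ℚ(ζ₃₃)/ℚ)`, the subgroup `{ζ ↦ ζ, ζ ↦ ζ¹⁰}` of order `2` (Shimura's `H₁`). [folklore] -/
def H : Subgroup (L33 ≃ₐ[ℚ] L33) := Subgroup.zpowers σ

/-- `|H| = 2`. [folklore] -/
theorem card_H : Nat.card H = 2 := by
  rw [H, Nat.card_zpowers, orderOf_σ]

/-- Elements of `H` send `ζ` to `ζ^(10^j)`, `j < 2`. [folklore] -/
theorem exists_apply_ζ_of_mem_H {g : L33 ≃ₐ[ℚ] L33} (hg : g ∈ H) : ∃ j : ℕ, j < 2 ∧ g ζ = ζ ^ (10 ^ j) := by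
  obtain ⟨k, rfl⟩ := Subgroup.mem_zpowers_iff.mp hg
  have hk : σ ^ k = σ ^ ((k % 2).toNat) := by
    have h1 := zpow_mod_orderOf σ k
    rw [orderOf_σ] at h1
    rw [← h1, ← zpow_natCast, Int.toNat_of_nonneg (Int.emod_nonneg k (by norm_num))]
    norm_cast
  refine ⟨(k % 2).toNat, ?_, ?_⟩
  · have : k % 2 < 2 := Int.emod_lt_of_pos k (by norm_num)
    omega
  · rw [hk, σ_pow_ζ]


/-! ### The field `K = ℚ(ζ₃₃)^H`, cyclic of degree `10` over `ℚ` -/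

/-- **The CM field of the witness**: `K := ℚ(ζ₃₃)^⟨σ⟩`, the fixed field of `H = {ζ ↦ ζ, ζ ↦ ζ¹⁰}`, a
subfield of degree `10` of `ℚ(ζ₃₃)` (cyclic over `ℚ`) containing `ζ₃ = ζ¹¹`. [folklore] -/
def K10 : IntermediateField ℚ L33 := IntermediateField.fixedField H

/-- `[ℚ(ζ₃₃) : K] = |H| = 2`. [folklore] -/
theorem finrank_K10_L33 : Module.finrank K10 L33 = 2 := by
  rw [K10, IntermediateField.finrank_fixedField_eq_card, card_H]

/-- `[K : ℚ] = 20 / 2 = 10`. [folklore] -/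
theorem finrank_K10 : Module.finrank ℚ K10 = 10 := by
  have h := Module.finrank_mul_finrank ℚ K10 L33
  rw [finrank_K10_L33, finrank_L33] at h
  omega

/-- `K` is a number field. [folklore] -/
instance instNumberFieldK10 : NumberField K10 := inferInstance

/-- The automorphisms of `ℚ(ζ₃₃)` fixing `K` pointwise are exactly `H` (Galois correspondence).
[folklore] -/
theorem fixingSubgroup_K10 : IntermediateField.fixingSubgroup K10 = H :=
  IntermediateField.fixingSubgroup_fixedField H

/-- `x ∈ K` iff `σ x = x`. [folklore] -/
theorem mem_K10_iff (x : L33) : x ∈ K10 ↔ σ x = x := by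
  rw [K10, IntermediateField.mem_fixedField_iff]
  constructor
  · intro h
    exact h σ (Subgroup.mem_zpowers σ)
  · intro h g hg
    have hle : H ≤ MulAction.stabilizer (L33 ≃ₐ[ℚ] L33) x := by
      rw [H, Subgroup.zpowers_le, MulAction.mem_stabilizer_iff]
      exact h
    exact hle hg

/-- Every complex embedding of `K` extends to one of `ℚ(ζ₃₃)` (`ℂ` is algebraically closed).
[folklore] -/
theorem exists_extension (φ : K10 →+* ℂ) :
    ∃ Φ : L33 →+* ℂ, Φ.comp (algebraMap K10 L33) = φ := by
  letI : Algebra K10 ℂ := φ.toAlgebra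
  let Φ : L33 →ₐ[K10] ℂ := IsAlgClosed.lift
  exact ⟨Φ.toRingHom, Φ.comp_algebraMap⟩

/-- **Two complex embeddings of `ℚ(ζ₃₃)` that agree on `K` differ by an element of `H`**: if
`Φ ζ = μ^a` then `Φ' ζ = μ^(a·10^j)` for some `j < 2`. (Galois theory: `ℚ(ζ₃₃)/K` is Galois with group
`H`.) [folklore] -/
theorem exists_exponent_of_comp_eq {Φ Φ' : L33 →+* ℂ}
    (h : Φ.comp (algebraMap K10 L33) = Φ'.comp (algebraMap K10 L33)) {a : ℕ} (ha : Φ ζ = μ ^ a) :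
    ∃ j : ℕ, j < 2 ∧ Φ' ζ = μ ^ (a * 10 ^ j) := by
  obtain ⟨g, hg⟩ := NumberField.ComplexEmbedding.exists_comp_symm_eq_of_comp_eq Φ Φ' h
  have hmem : g.symm.restrictScalars ℚ ∈ H := by
    rw [← fixingSubgroup_K10, IntermediateField.mem_fixingSubgroup_iff]
    intro x hx
    exact g.symm.commutes ⟨x, hx⟩
  obtain ⟨j, hj, hjζ⟩ := exists_apply_ζ_of_mem_H hmem
  refine ⟨j, hj, ?_⟩
  rw [← hg, RingHom.comp_apply, pow_mul, ← ha, ← map_pow]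
  exact congrArg Φ hjζ

/-- Residue arithmetic: `-1 ∉ H`, i.e. `32·a ≢ a·10^j (mod 33)` for units `a` and `j < 2`. Decided by
the kernel. [folklore] -/
theorem core_negOne_notMem_H : ∀ a : ℕ, a < 33 → a.Coprime 33 → ∀ j : ℕ, j < 2 →
    (32 * a) % 33 ≠ (a * 10 ^ j) % 33 := by
  decide

/-- **`K` is totally complex**: complex conjugation on `ℚ(ζ₃₃)` (`ζ ↦ ζ⁻¹ = ζ³²`) does not lie in
`H = {ζ ↦ ζ, ζ¹⁰}`, so no complex embedding of `K` is real. [folklore] -/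
instance instIsTotallyComplexK10 : IsTotallyComplex K10 := by
  refine ⟨fun v ↦ ?_⟩
  rw [← NumberField.InfinitePlace.not_isReal_iff_isComplex, NumberField.InfinitePlace.isReal_iff,
    NumberField.ComplexEmbedding.isReal_iff]
  intro hreal
  obtain ⟨Φ, hΦ⟩ := exists_extension v.embedding
  obtain ⟨a, ha, hac, hΦa⟩ := exists_apply_ζ_eq Φ
  have hconj : Φ.comp (algebraMap K10 L33) =
      (NumberField.ComplexEmbedding.conjugate Φ).comp (algebraMap K10 L33) := by
    ext x
    have hx := RingHom.congr_fun hΦ x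
    rw [RingHom.comp_apply] at hx
    rw [RingHom.comp_apply, RingHom.comp_apply, NumberField.ComplexEmbedding.conjugate_coe_eq, hx,
      ← NumberField.ComplexEmbedding.conjugate_coe_eq, hreal]
  obtain ⟨j, hj, hjζ⟩ := exists_exponent_of_comp_eq hconj hΦa
  have h32 : NumberField.ComplexEmbedding.conjugate Φ ζ = μ ^ (32 * a) := by
    rw [NumberField.ComplexEmbedding.conjugate_coe_eq, hΦa, map_pow, conj_μ, ← pow_mul]
  have heq : μ ^ ((32 * a) % 33) = μ ^ ((a * 10 ^ j) % 33) := by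
    rw [← μ_pow_mod, ← μ_pow_mod, ← h32, hjζ]
  exact core_negOne_notMem_H a ha hac j hj
    (μ_pow_inj (Nat.mod_lt _ (by norm_num)) (Nat.mod_lt _ (by norm_num)) heq)

/-- `K/ℚ` is abelian (a subextension of the cyclotomic, hence abelian, extension `ℚ(ζ₃₃)/ℚ`;
Mathlib's `IsAbelianGalois.of_algHom` along the inclusion `K ⊂ ℚ(ζ₃₃)`), stated for the canonical
`ℚ`-algebra structure `DivisionRing.toRatAlgebra` that `NumberField.IsCMField.of_isAbelianGalois` consumes.
[folklore] -/
instance instIsAbelianGaloisK10 : @IsAbelianGalois ℚ K10 _ _ DivisionRing.toRatAlgebra :=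
  haveI : IsAbelianGalois ℚ L33 := IsCyclotomicExtension.isAbelianGalois {33} ℚ L33
  IsAbelianGalois.of_algHom (K := ℚ) (L := K10) (M := L33) (algebraMap K10 L33).toRatAlgHom

/-- `K/ℚ` is integral (a number field), for the canonical `ℚ`-algebra structure. [folklore] -/
instance instIsIntegralK10 : @Algebra.IsIntegral ℚ K10 _ _ DivisionRing.toRatAlgebra :=
  inferInstance

/-- **`K` is a CM field** (a totally complex abelian number field; Mathlib's
`NumberField.IsCMField.of_isAbelianGalois`). [folklore] -/
instance instIsCMFieldK10 : IsCMField K10 := IsCMField.of_isAbelianGalois K10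

/-! ### The cube root of unity `ω = ζ¹¹ ∈ K` -/

/-- `ζ¹¹ ∈ K`: `σ(ζ¹¹) = ζ¹¹⁰ = ζ¹¹` (`110 ≡ 11 mod 33`). [folklore] -/
theorem ζ_pow_eleven_mem_K10 : ζ ^ 11 ∈ K10 := by
  rw [mem_K10_iff, map_pow, σ_ζ, ← pow_mul, ζ_pow_mod (10 * 11)]

/-- `ω := ζ¹¹`, as an element of `K` (decl `zeta3K`). [folklore] -/
def zeta3K : K10 := ⟨ζ ^ 11, ζ_pow_eleven_mem_K10⟩

/-- `ω ∈ K` is a primitive cube root of unity (`ζ` has order `33 = 11 · 3`; primitivity is inherited along the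
injection `K ⊂ ℚ(ζ₃₃)`), so `K ⊃ ℚ(ω) = ℚ(√-3)` and `(2ω + 1)² = -3` in `𝓞_K`. [folklore] -/
theorem isPrimitiveRoot_zeta3K : IsPrimitiveRoot zeta3K 3 := by
  have h : IsPrimitiveRoot (algebraMap K10 L33 zeta3K) 3 :=
    isPrimitiveRoot_ζ.pow (by norm_num) (show (33 : ℕ) = 11 * 3 by norm_num)
  exact h.of_map_of_injective (algebraMap K10 L33).injective

end Cyclotomic33

end Summit.HodgeConjecture.HodgeConjecture.Ring2.Atlas

end
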